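import Summits.QuantumFields.YangMills.Theorems.BalabanUVNodesN21LowCentreDilation
import Literature.MathematicalPhysics.QuantumFieldTheory.Balaban1983to89.B15BasicStep

/-!
# N21 (NE7c) · THE LOCATED NUMERAL OF THE LOW-CENTRE ROAD, AT THE RECORD'S LETTERS
# (`2G∕γ ≤ l₀(θ(1−ρ)−c₀)∕L` of `lowCentre_certificate`; plan g77 W-SEAT-START-LIST v3 §n21 item 1)

Width seat pub-ymgap-dag-n21-w1 (g0; director-ym №197 ∕ HUMAN RULING D-0149), node N21 = NE7c (single-run shell-weight
bound, NOT PRINTED in [Bałaban 1983–89], NOT proved), lane K3⁷ `SpineGivenEndpointR13SepCoPH` (stmt-QuantumFields-20544,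
`--kind proof --supports … --as helper`).  Consumes BY NAME n21-d part 31 `…N21LowCentreDilation`
(`slotAntiConcentration_restrict_of_lowCentre`, lens ROW P″ corollary) and part 30 `…N21LowCentreNonCollapse`
(`lowCentre_certificate`, lens Card 81); the (1.48) leaf `B15.BasicStep.Ineq148` of [Balaban1989LargeFieldI] p.186.

WHY.  On the low-centre road the re-centred END (part 28 P2) has its non-collapse binder `hmono` discharged by convexity
about a centre that is LOW seen from the shell (part 30 `hmono_of_lowCentre`); part 31 and n21-e's 38m keep that
lowness `hlow` as a displayed HYPOTHESIS, and part 30 certifies it pointwise by `lowCentre_certificate` under ONE located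
real inequality — the numeral `hnum : 2G∕γ ≤ l₀·(θ(1−ρ) − c₀)∕L` (γ-strong convexity about the centre with gradient
residual `G`, an `L`-Lipschitz statistic, core reading `c₀`, relative shell width `ρ`, contraction `l₀ = 1 − 1∕(#κ+1)`).
The dag-lead's TABLE v54∕v55 row n21 names this numeral as «the located residual of the dilation road»; this file
(i) discharges `hlow` in part 31's END by the certificate BY NAME, so that the numeral is the END's only located real
inequality (§1); (ii) reads the numeral at the record's letters (§2): `l₀ ≥ ½` (block dimension `≥ 1`), core reading
RELATIVE to the letter (lens N210 ∕ Card 90 (v): `|m_b| ≤ σθ_b`, `σ ≤ ½` same step ∕ `αβ2^{−a}` at age `a`), and at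
[LF-I] p.186 (1.48)–(1.49) AS PRINTED (ME #31, desk l.22889∕l.22903∕l.22908): threshold
`θ = (1 − β(1 − s∕2))·L₀pow·εE` ((1.49), `B15.BasicStep.SF149`), tilt `c₀ = αβs·εE` (the additive term of (1.48) —
`coreReading_le_of_ineq148_at_centre`: it IS the reading of a configuration whose new deviation vanishes, BY NAME), modulus
`L = 1 + αβs` (the multiplicative factor of (1.48)); under print's `α ≤ 1∕8`, `0 ≤ β ≤ ½`, `0 ≤ s ≤ 1`, `L₀pow ≥ 1`
(p.182, p.187; `coeff150_le_coeff149_iff`, `coeff152_lt_one`) and `ρ ≤ ½` the numeral FOLLOWS FROM `24·G ≤ γ·εE` and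
(converse, any letters) FORCES `2·G·L ≤ γ·θ` — so at the record the numeral is ONE located letter ratio `G∕(γ·εE)` below an
absolute constant: `G` = gradient residual of the non-quadratic block action at the centre ([CMP 116]; [LF-II]
(1.5)–(1.9) «positive-definite quadratic form + dominated remainder»), `γ = γ₀` = the uniform lower bound of `C*Δ_kC`
([CMP 99] p.428; at `U = 1` [CMP 96] (2.157), tree `B6.bound2157`) — desk ROW Q′ l.23652∕l.23665, LOCATED, parametric in
print, NOT asserted; (iii) the END at those letters (§3); (iv) the A6 witness (§4): every binder of §3 (hence of §1)
discharged in the kernel with a centre that is NOT the minimiser (the clause `24·G ≤ γ·εE` with equality).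

HONEST FRAMING.  [textbook] convexity ∕ real arithmetic + by-name citation of PROVED B15 rows; 0 def, 0 sorry; located
letters are HYPOTHESES or print's numerics; nothing of Bałaban's asserted; NE7c NOT PRINTED ∕ NOT proved; N21 NOT
discharged; counts unmoved (typed 28∕28 · discharged 5∕27); count-neutral; one finite 𝕋⁴ at fixed ε — R4 would close only
the conditional finite-𝕋⁴ rung `BalabanLadder.UV`, NOT the Yang–Mills mass gap (Clay); nothing about ℝ⁴ ∕ OS.
-/

set_option autoImplicit false

open MeasureTheory Set Function
open scoped ENNReal

namespace Summit.QuantumFields.YangMills.Theorems.N21LowCentreNumeral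

open Literature.MathematicalPhysics.QuantumFieldTheory.Balaban1983to89
open Literature.MathematicalPhysics.QuantumFieldTheory.Balaban1983to89.T4ShellMeasure (SlotAntiConcentration)
open Summit.QuantumFields.YangMills.Theorems.N21LowCentreDilation (slotAntiConcentration_restrict_of_lowCentre)
open Summit.QuantumFields.YangMills.Theorems.N21LowCentreNonCollapse (lowCentre_certificate)

/-! ## §0  The record's contraction `l₀ = 1 − 1∕(#κ+1)` -/

section Contraction

variable (κ : Type*) [Fintype κ]

/-- `0 < 1 − 1∕(#κ+1)` (the dilation road's contraction ratio, parts 16 ∕ 28). [textbook] -/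
theorem recordContraction_pos [Nonempty κ] : 0 < 1 - 1 / ((Fintype.card κ : ℝ) + 1) := by
  have hcard : (1 : ℝ) ≤ (Fintype.card κ : ℝ) := by exact_mod_cast Fintype.card_pos
  have : 1 / ((Fintype.card κ : ℝ) + 1) < 1 := by
    rw [div_lt_one (by positivity)]
    linarith
  linarith

/-- `½ ≤ 1 − 1∕(#κ+1)` for a block of dimension `#κ ≥ 1`: the record's contraction is at least one half. [textbook] -/
theorem half_le_recordContraction [Nonempty κ] : 1 / 2 ≤ 1 - 1 / ((Fintype.card κ : ℝ) + 1) := by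
  have hcard : (1 : ℝ) ≤ (Fintype.card κ : ℝ) := by exact_mod_cast Fintype.card_pos
  have : 1 / ((Fintype.card κ : ℝ) + 1) ≤ 1 / 2 := by
    rw [div_le_div_iff₀ (by positivity) (by norm_num)]
    linarith
  linarith

/-- `1 − 1∕(#κ+1) ≤ 1`. [textbook] -/
theorem recordContraction_le_one : 1 - 1 / ((Fintype.card κ : ℝ) + 1) ≤ 1 := by
  have : 0 ≤ 1 / ((Fintype.card κ : ℝ) + 1) := by positivity
  linarith

end Contraction

/-! ## §1  Part 31's END with the lowness binder DISCHARGED by the certificate -/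

section CertifiedEnd

variable {X : Type*} [MeasurableSpace X] {κ : Type*} [Fintype κ]

/-- ★ **(M1) ON THE CUT LAW ABOUT A CERTIFIED LOW CENTRE.**  Part 31's `slotAntiConcentration_restrict_of_lowCentre`
(density `𝟙_{K p.1}(p.2)·e^{−φ_{p.1}(p.2)}`, kept CONVEX cuts, CONVEX block potential, envelope `henv`, radial
transversality `hRT`, odds `hQ`) with its lowness binder `hlow` DISCHARGED fibrewise by part 30's `lowCentre_certificate`:
displayed instead are the first-order model `hmodel` (γ-strong convexity of `φ_z` about the centre `m z` on `K z` with
gradient residual `G`, in the block chart's sup norm), the `L`-Lipschitz statistic `hU`, the core reading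
`hUm : U(z, m z) ≤ c₀`, and the ONE located numeral `hnum : 2G∕γ ≤ (1 − 1∕(#κ+1))·(θ(1−ρ) − c₀)∕L`.
Constant unchanged: `3(#κ+1)(1+Q)∕(κ₀(1−ρ))`. [textbook] -/
theorem slotAntiConcentration_restrict_of_certifiedLowCentre [Nonempty κ] (ζ : Measure X) [SFinite ζ]
    {m : X → (κ → ℝ)} (hm : Measurable m) (K : X → Set (κ → ℝ)) (φ : X → (κ → ℝ) → ℝ)
    (hg : Measurable fun p : X × (κ → ℝ) =>
      (K p.1).indicator (fun w => ENNReal.ofReal (Real.exp (-φ p.1 w))) p.2)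
    {U : X × (κ → ℝ) → ℝ} (hUm : Measurable U)
    {C Env : Set (X × (κ → ℝ))} (hC : MeasurableSet C) (hEnv : MeasurableSet Env)
    {θ ρ κ₀ Q G γ L c₀ : ℝ} (hθ : 0 < θ) (hρ0 : 0 < ρ) (hρ1 : ρ < 1) (hκ : 0 < κ₀) (hQ0 : 0 ≤ Q)
    (hγ : 0 < γ) (hL : 0 < L)
    (hK : ∀ z, Convex ℝ (K z)) (hφ : ∀ z, ConvexOn ℝ (K z) (φ z)) (hmK : ∀ z, m z ∈ K z)
    (hmodel : ∀ z, ∀ v ∈ K z, φ z (m z) - G * ‖v - m z‖ + γ / 2 * ‖v - m z‖ ^ 2 ≤ φ z v)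
    (hU : ∀ z (a b : κ → ℝ), U (z, a) - U (z, b) ≤ L * ‖a - b‖)
    (hUc : ∀ z, U (z, m z) ≤ c₀)
    (hnum : 2 * G / γ ≤ (1 - 1 / ((Fintype.card κ : ℝ) + 1)) * ((θ * (1 - ρ) - c₀) / L))
    (henv : ∀ l ∈ Icc (1 - 1 / ((Fintype.card κ : ℝ) + 1)) 1, ∀ p : X × (κ → ℝ),
      θ * (1 - ρ) ≤ U p → U p < θ → p ∈ C → (p.1, m p.1 + l • (p.2 - m p.1)) ∈ Env)
    (hRT : ∀ p : X × (κ → ℝ), θ * (1 - ρ) ≤ U p → U p < θ → p ∈ C → ∀ s : ℝ, 1 ≤ s →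
      θ * (1 - ρ) ≤ U (p.1, m p.1 + s • (p.2 - m p.1)) → U (p.1, m p.1 + s • (p.2 - m p.1)) < θ →
        (p.1, m p.1 + s • (p.2 - m p.1)) ∈ C →
          U p + κ₀ * (θ * (1 - ρ)) * (s - 1) ≤ U (p.1, m p.1 + s • (p.2 - m p.1)))
    (hQ : ((ζ.prod volume).withDensity fun p : X × (κ → ℝ) =>
        (K p.1).indicator (fun w => ENNReal.ofReal (Real.exp (-φ p.1 w))) p.2) (Env \ ({p | U p < θ} ∩ C))
      ≤ ENNReal.ofReal Q * ((ζ.prod volume).withDensity fun p : X × (κ → ℝ) =>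
        (K p.1).indicator (fun w => ENNReal.ofReal (Real.exp (-φ p.1 w))) p.2) ({p | U p < θ} ∩ C)) :
    SlotAntiConcentration
      ((((ζ.prod volume).withDensity fun p : X × (κ → ℝ) =>
          (K p.1).indicator (fun w => ENNReal.ofReal (Real.exp (-φ p.1 w))) p.2)).restrict ({p | U p < θ} ∩ C))
      U θ ρ (3 * ((Fintype.card κ : ℝ) + 1) * (1 + Q) / (κ₀ * (1 - ρ))) := by
  refine slotAntiConcentration_restrict_of_lowCentre ζ hm K φ hg hUm hC hEnv hθ hρ0 hρ1 hκ hQ0 hK hφ hmK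
    ?_ henv hRT hQ
  intro p h1 _ _ hw
  exact lowCentre_certificate (hK p.1) (U := fun w => U (p.1, w)) hγ hL (recordContraction_pos κ)
    (recordContraction_le_one κ) (hmodel p.1) (fun a b => hU p.1 a b) (hmK p.1) hw (hUc p.1) h1 hnum

end CertifiedEnd

/-! ## §2  The numeral at the record's letters [real arithmetic] -/

section Numeral

/-- **THE NUMERAL FROM A RELATIVE CORE READING.**  If the centre's reading is RELATIVE to the letter, `c₀ ≤ σθ` (lens
N210 ∕ Card 90 (v): `σ ≤ ½` same step, `αβ2^{−a}` at age `a`), `ρ + σ ≤ 1`, and the contraction is at least one half, then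
`4·G·L ≤ γ·θ(1 − ρ − σ)` gives the numeral `2G∕γ ≤ l₀(θ(1−ρ) − c₀)∕L`. [textbook] -/
theorem numeral_of_relativeReading {G γ L c₀ θ ρ σ l₀ : ℝ} (hγ : 0 < γ) (hL : 0 < L) (hθ : 0 ≤ θ)
    (hl₀ : 1 / 2 ≤ l₀) (hρσ : ρ + σ ≤ 1) (hc₀ : c₀ ≤ σ * θ)
    (hG : 4 * G * L ≤ γ * (θ * (1 - ρ - σ))) :
    2 * G / γ ≤ l₀ * ((θ * (1 - ρ) - c₀) / L) := by
  have hX : 0 ≤ θ * (1 - ρ - σ) := mul_nonneg hθ (by linarith)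
  have h1 : 2 * G / γ ≤ θ * (1 - ρ - σ) / (2 * L) := by
    rw [div_le_div_iff₀ hγ (by positivity)]
    nlinarith
  have h2 : θ * (1 - ρ - σ) / (2 * L) ≤ l₀ * ((θ * (1 - ρ) - c₀) / L) := by
    have hY : θ * (1 - ρ - σ) ≤ θ * (1 - ρ) - c₀ := by nlinarith
    have hY0 : 0 ≤ (θ * (1 - ρ) - c₀) / L := div_nonneg (hX.trans hY) hL.le
    calc θ * (1 - ρ - σ) / (2 * L) = 1 / 2 * (θ * (1 - ρ - σ) / L) := by
          field_simp
      _ ≤ 1 / 2 * ((θ * (1 - ρ) - c₀) / L) :=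
          mul_le_mul_of_nonneg_left (div_le_div_of_nonneg_right hY hL.le) (by norm_num)
      _ ≤ l₀ * ((θ * (1 - ρ) - c₀) / L) := mul_le_mul_of_nonneg_right hl₀ hY0
  exact h1.trans h2

/-- **CONVERSELY, THE NUMERAL FORCES A SMALLNESS OF THE LETTER RATIO.**  For `c₀ ≥ 0`, `ρ ≥ 0`, `0 ≤ l₀ ≤ 1` the numeral
implies `2·G·L ≤ γ·θ`: at the record the numeral is, up to an absolute factor, the ONE located clause «gradient residual
of the non-quadratic block action × Lipschitz modulus ≤ coercivity × threshold». [textbook] -/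
theorem smallness_of_numeral {G γ L c₀ θ ρ l₀ : ℝ} (hγ : 0 < γ) (hL : 0 < L) (hθ : 0 ≤ θ) (hρ : 0 ≤ ρ)
    (hc₀ : 0 ≤ c₀) (hl₀0 : 0 ≤ l₀) (hl₀1 : l₀ ≤ 1)
    (hnum : 2 * G / γ ≤ l₀ * ((θ * (1 - ρ) - c₀) / L)) : 2 * G * L ≤ γ * θ := by
  have hx : θ * (1 - ρ) - c₀ ≤ θ := by nlinarith [mul_nonneg hθ hρ]
  have h1 : l₀ * ((θ * (1 - ρ) - c₀) / L) ≤ θ / L :=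
    calc l₀ * ((θ * (1 - ρ) - c₀) / L) ≤ l₀ * (θ / L) :=
          mul_le_mul_of_nonneg_left (div_le_div_of_nonneg_right hx hL.le) hl₀0
      _ ≤ 1 * (θ / L) := mul_le_mul_of_nonneg_right hl₀1 (div_nonneg hθ hL.le)
      _ = θ / L := one_mul _
  have h2 : 2 * G / γ ≤ θ / L := hnum.trans h1
  rw [div_le_div_iff₀ hγ hL] at h2
  linarith

/-- **THE CORE READING IS (1.48)'s ADDITIVE TERM, BY NAME.**  [Balaban1989LargeFieldI] p.186 (1.48)
(`B15.BasicStep.Ineq148 dev dev′ α β s εE := dev ≤ dev′(1 + αβs) + αβs·εE`) at a configuration whose NEW deviation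
`dev′ = |U^{(n+1)}(∂p) − 1|` vanishes reads `dev ≤ αβs·εE`: the exterior-induced tilt of the old reading — the centre's
core reading `c₀` of the low-centre road in print's currency (ME #31; lens N210 ∕ N212). [textbook] -/
theorem coreReading_le_of_ineq148_at_centre {dev α β s εE : ℝ} (h : B15.BasicStep.Ineq148 dev 0 α β s εE) :
    dev ≤ α * β * s * εE := by
  unfold B15.BasicStep.Ineq148 at h
  simpa using h

/-- **THE MARGIN AT THE (1.48)∕(1.49) LETTERS.**  With the slot letter `θ = (1 − β(1 − s∕2))·P·E` ((1.49) at level `n`,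
`P = L₀^{2max{0,i−k₀−1}} ≥ 1`, `E = ε_i(L^{k−i}η)² ≥ 0`, `s = 2^{−(j−i)}`), the tilt `c₀ = αβs·E` of (1.48), print's
`α ≤ 1∕8`, `0 ≤ β ≤ ½`, `0 ≤ s ≤ 1` ([LF-I] p.182, p.187) and a relative shell width `ρ ≤ ½`:
`θ(1−ρ) − c₀ ≥ (3∕16)·E`. [textbook] -/
theorem margin148_ge {α β s P E ρ : ℝ} (hα : α ≤ 1 / 8) (hβ0 : 0 ≤ β) (hβ : β ≤ 1 / 2)
    (hs0 : 0 ≤ s) (hs1 : s ≤ 1) (hP : 1 ≤ P) (hE : 0 ≤ E) (hρ : ρ ≤ 1 / 2) :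
    3 / 16 * E ≤ (1 - β * (1 - s / 2)) * P * E * (1 - ρ) - α * β * s * E := by
  have hc : 1 / 2 ≤ 1 - β * (1 - s / 2) := by nlinarith
  have hcP : 1 / 2 ≤ (1 - β * (1 - s / 2)) * P := by nlinarith
  have hE1 : 0 ≤ E * (1 - ρ) := mul_nonneg hE (by linarith)
  have h1 : 1 / 4 * E ≤ (1 - β * (1 - s / 2)) * P * E * (1 - ρ) := by
    have h := mul_le_mul_of_nonneg_right hcP hE1
    nlinarith
  have hαβ : α * β ≤ 1 / 16 := by
    have h := mul_le_mul hα hβ hβ0 (by norm_num : (0 : ℝ) ≤ 1 / 8)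
    linarith
  have hαβs : α * β * s ≤ 1 / 16 := by nlinarith [mul_nonneg hs0 (sub_nonneg.2 hαβ)]
  have h2 : α * β * s * E ≤ 1 / 16 * E := mul_le_mul_of_nonneg_right hαβs hE
  linarith

/-- the (1.48) modulus `1 + αβs` lies in `(0, 17∕16]` under print's `α ≤ 1∕8`, `β ≤ ½`, `s ≤ 1`. [textbook] -/
theorem lipschitz148_le {α β s : ℝ} (hα0 : 0 ≤ α) (hα : α ≤ 1 / 8) (hβ0 : 0 ≤ β) (hβ : β ≤ 1 / 2)
    (hs0 : 0 ≤ s) (hs1 : s ≤ 1) : 0 < 1 + α * β * s ∧ 1 + α * β * s ≤ 17 / 16 := by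
  have hαβ : α * β ≤ 1 / 8 * (1 / 2) := mul_le_mul hα hβ hβ0 (by norm_num)
  have h0 : 0 ≤ α * β * s := mul_nonneg (mul_nonneg hα0 hβ0) hs0
  have hαβs : α * β * s ≤ 1 / 16 := by nlinarith
  exact ⟨by linarith, by linarith⟩

/-- ★ **THE NUMERAL AT THE (1.48)∕(1.49) LETTERS, AS PRINTED.**  Slot letter `θ = (1 − β(1 − s∕2))·P·E` ((1.49)),
core reading `c₀ = αβs·E` and modulus `L = 1 + αβs` ((1.48)), contraction `l₀ ≥ ½`, relative shell width `ρ ≤ ½`,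
print's `0 ≤ α ≤ 1∕8`, `0 ≤ β ≤ ½`, `0 ≤ s ≤ 1`, `P ≥ 1`, `E ≥ 0`: the located numeral of `lowCentre_certificate` FOLLOWS
FROM the one clause `24·G ≤ γ·E` — gradient residual of the non-quadratic block action over the coercivity `γ₀` at most
`1∕24` of the small-field unit `ε_i(L^{k−i}η)²` (G, γ₀ LOCATED: [CMP 116]; [CMP 99] p.428 ∕ [CMP 96] (2.157); desk ROW Q′).
[textbook] -/
theorem numeral_at148Letters {G γ α β s P E ρ l₀ : ℝ} (hγ : 0 < γ) (hα0 : 0 ≤ α) (hα : α ≤ 1 / 8)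
    (hβ0 : 0 ≤ β) (hβ : β ≤ 1 / 2) (hs0 : 0 ≤ s) (hs1 : s ≤ 1) (hP : 1 ≤ P) (hE : 0 ≤ E)
    (hρ : ρ ≤ 1 / 2) (hl₀ : 1 / 2 ≤ l₀) (hG : 24 * G ≤ γ * E) :
    2 * G / γ ≤ l₀ * (((1 - β * (1 - s / 2)) * P * E * (1 - ρ) - α * β * s * E) / (1 + α * β * s)) := by
  obtain ⟨hLc0, hLc⟩ := lipschitz148_le hα0 hα hβ0 hβ hs0 hs1
  have hM := margin148_ge hα hβ0 hβ hs0 hs1 hP hE hρ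
  set M : ℝ := (1 - β * (1 - s / 2)) * P * E * (1 - ρ) - α * β * s * E with hMdef
  have h1 : 2 * G / γ ≤ E / 12 := by
    rw [div_le_iff₀ hγ]
    linarith
  have h2 : 3 * E / 17 ≤ M / (1 + α * β * s) := by
    rw [le_div_iff₀ hLc0]
    nlinarith
  have h3 : 0 ≤ M / (1 + α * β * s) := le_trans (by positivity) h2
  have h4 : 1 / 2 * (M / (1 + α * β * s)) ≤ l₀ * (M / (1 + α * β * s)) := mul_le_mul_of_nonneg_right hl₀ h3
  linarith

/-- the same at the record's contraction `l₀ = 1 − 1∕(#κ+1)` (block of dimension `#κ ≥ 1`). [textbook] -/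
theorem numeral_at148Letters_record (κ : Type*) [Fintype κ] [Nonempty κ] {G γ α β s P E ρ : ℝ} (hγ : 0 < γ)
    (hα0 : 0 ≤ α) (hα : α ≤ 1 / 8) (hβ0 : 0 ≤ β) (hβ : β ≤ 1 / 2) (hs0 : 0 ≤ s) (hs1 : s ≤ 1) (hP : 1 ≤ P)
    (hE : 0 ≤ E) (hρ : ρ ≤ 1 / 2) (hG : 24 * G ≤ γ * E) :
    2 * G / γ ≤ (1 - 1 / ((Fintype.card κ : ℝ) + 1)) *
      (((1 - β * (1 - s / 2)) * P * E * (1 - ρ) - α * β * s * E) / (1 + α * β * s)) :=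
  numeral_at148Letters hγ hα0 hα hβ0 hβ hs0 hs1 hP hE hρ (half_le_recordContraction κ) hG

/-- **THE NUMERAL AT A SAME-STEP LINK LETTER.**  Letter `θ = δ` (print's `δ_j`), core reading at most one half of the
letter (`c₀ ≤ ½δ`: [LF-I] (1.39) `½δ_j`, lens N210), coordinate statistic (`L = 1`, sup norm), `l₀ ≥ ½`,
relative shell width `ρ ≤ ¼`:
`16·G ≤ γ·δ` gives the numeral. [textbook] -/
theorem numeral_atLinkLetter {G γ c₀ δ ρ l₀ : ℝ} (hγ : 0 < γ) (hδ : 0 ≤ δ) (hl₀ : 1 / 2 ≤ l₀)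
    (hρ : ρ ≤ 1 / 4) (hc₀ : c₀ ≤ 1 / 2 * δ) (hG : 16 * G ≤ γ * δ) :
    2 * G / γ ≤ l₀ * ((δ * (1 - ρ) - c₀) / 1) := by
  refine numeral_of_relativeReading hγ one_pos hδ hl₀ (σ := 1 / 2) (by linarith) hc₀ ?_
  have h0 : 0 ≤ γ * δ * (1 / 4 - ρ) := mul_nonneg (mul_nonneg hγ.le hδ) (by linarith)
  nlinarith [h0]

end Numeral

/-! ## §3  The END at the (1.48)∕(1.49) letters -/

section EndAtLetters

variable {X : Type*} [MeasurableSpace X] {κ : Type*} [Fintype κ]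

/-- ★★ **(M1) ON THE CUT LAW ABOUT A LOW CENTRE, AT THE (1.48)∕(1.49) LETTERS.**  §1 with the slot letter
`θ = (1 − β(1 − s∕2))·P·E` ((1.49)), the core reading `U(z, m z) ≤ αβs·E` and the modulus `L = 1 + αβs` ((1.48)),
print's `0 ≤ α ≤ 1∕8`, `0 ≤ β ≤ ½`, `0 ≤ s ≤ 1`, `P ≥ 1`, `E > 0` and `0 < ρ ≤ ½`: the only located real inequality
displayed is `24·G ≤ γ·E` (G = gradient residual of the non-quadratic block action about the centre, γ = its coercivity
`γ₀`; LOCATED at the desk's ROW Q′, NOT asserted).  Constant `3(#κ+1)(1+Q)∕(κ₀(1−ρ))`. [textbook] -/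
theorem slotAntiConcentration_restrict_of_lowCentre_at148Letters [Nonempty κ] (ζ : Measure X) [SFinite ζ]
    {m : X → (κ → ℝ)} (hm : Measurable m) (K : X → Set (κ → ℝ)) (φ : X → (κ → ℝ) → ℝ)
    (hg : Measurable fun p : X × (κ → ℝ) =>
      (K p.1).indicator (fun w => ENNReal.ofReal (Real.exp (-φ p.1 w))) p.2)
    {U : X × (κ → ℝ) → ℝ} (hUm : Measurable U)
    {C Env : Set (X × (κ → ℝ))} (hC : MeasurableSet C) (hEnv : MeasurableSet Env)
    {α β s P E ρ κ₀ Q G γ : ℝ} (hα0 : 0 ≤ α) (hα : α ≤ 1 / 8) (hβ0 : 0 ≤ β) (hβ : β ≤ 1 / 2)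
    (hs0 : 0 ≤ s) (hs1 : s ≤ 1) (hP : 1 ≤ P) (hE : 0 < E) (hρ0 : 0 < ρ) (hρ : ρ ≤ 1 / 2) (hκ : 0 < κ₀)
    (hQ0 : 0 ≤ Q) (hγ : 0 < γ) (hG : 24 * G ≤ γ * E)
    (hK : ∀ z, Convex ℝ (K z)) (hφ : ∀ z, ConvexOn ℝ (K z) (φ z)) (hmK : ∀ z, m z ∈ K z)
    (hmodel : ∀ z, ∀ v ∈ K z, φ z (m z) - G * ‖v - m z‖ + γ / 2 * ‖v - m z‖ ^ 2 ≤ φ z v)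
    (hU : ∀ z (a b : κ → ℝ), U (z, a) - U (z, b) ≤ (1 + α * β * s) * ‖a - b‖)
    (hUc : ∀ z, U (z, m z) ≤ α * β * s * E)
    (henv : ∀ l ∈ Icc (1 - 1 / ((Fintype.card κ : ℝ) + 1)) 1, ∀ p : X × (κ → ℝ),
      (1 - β * (1 - s / 2)) * P * E * (1 - ρ) ≤ U p → U p < (1 - β * (1 - s / 2)) * P * E → p ∈ C →
        (p.1, m p.1 + l • (p.2 - m p.1)) ∈ Env)
    (hRT : ∀ p : X × (κ → ℝ), (1 - β * (1 - s / 2)) * P * E * (1 - ρ) ≤ U p →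
      U p < (1 - β * (1 - s / 2)) * P * E → p ∈ C → ∀ r : ℝ, 1 ≤ r →
      (1 - β * (1 - s / 2)) * P * E * (1 - ρ) ≤ U (p.1, m p.1 + r • (p.2 - m p.1)) →
        U (p.1, m p.1 + r • (p.2 - m p.1)) < (1 - β * (1 - s / 2)) * P * E →
        (p.1, m p.1 + r • (p.2 - m p.1)) ∈ C →
          U p + κ₀ * ((1 - β * (1 - s / 2)) * P * E * (1 - ρ)) * (r - 1) ≤ U (p.1, m p.1 + r • (p.2 - m p.1)))
    (hQ : ((ζ.prod volume).withDensity fun p : X × (κ → ℝ) =>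
        (K p.1).indicator (fun w => ENNReal.ofReal (Real.exp (-φ p.1 w))) p.2)
          (Env \ ({p | U p < (1 - β * (1 - s / 2)) * P * E} ∩ C))
      ≤ ENNReal.ofReal Q * ((ζ.prod volume).withDensity fun p : X × (κ → ℝ) =>
        (K p.1).indicator (fun w => ENNReal.ofReal (Real.exp (-φ p.1 w))) p.2)
          ({p | U p < (1 - β * (1 - s / 2)) * P * E} ∩ C)) :
    SlotAntiConcentration
      ((((ζ.prod volume).withDensity fun p : X × (κ → ℝ) =>
          (K p.1).indicator (fun w => ENNReal.ofReal (Real.exp (-φ p.1 w))) p.2)).restrict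
        ({p | U p < (1 - β * (1 - s / 2)) * P * E} ∩ C))
      U ((1 - β * (1 - s / 2)) * P * E) ρ (3 * ((Fintype.card κ : ℝ) + 1) * (1 + Q) / (κ₀ * (1 - ρ))) := by
  have hc : 1 / 2 ≤ 1 - β * (1 - s / 2) := by nlinarith
  have hθ : 0 < (1 - β * (1 - s / 2)) * P * E := by positivity
  obtain ⟨hLc0, -⟩ := lipschitz148_le hα0 hα hβ0 hβ hs0 hs1
  have hnum := numeral_at148Letters_record κ hγ hα0 hα hβ0 hβ hs0 hs1 hP hE.le hρ hG
  exact slotAntiConcentration_restrict_of_certifiedLowCentre ζ hm K φ hg hUm hC hEnv hθ hρ0 (by linarith) hκ hQ0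
    hγ hLc0 hK hφ hmK hmodel hU hUc hnum henv hRT hQ

end EndAtLetters

/-! ## §4  A6 witness: every binder of §3 (hence of §1) discharged, the centre NOT the minimiser -/

section Witness

/-- the tilted quadratic `w ↦ w₀²∕2 − w₀∕24` on `ℝ¹` is convex. [textbook] -/
theorem convexOn_tiltedQuadratic_one :
    ConvexOn ℝ univ fun w : Fin 1 → ℝ => w 0 ^ 2 / 2 - w 0 / 24 := by
  refine ⟨convex_univ, fun x _ y _ a b ha hb hab => ?_⟩
  have hb' : b = 1 - a := by linarith
  subst hb'
  simp only [Pi.add_apply, Pi.smul_apply, smul_eq_mul]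
  nlinarith [mul_nonneg (mul_nonneg ha hb) (sq_nonneg (x 0 - y 0))]

/-- **A6 WITNESS OF THE ★★ END (hence of ★ §1, which it calls)** (director-ym STANDING A6 RULE №189 (3)):
`slotAntiConcentration_restrict_of_lowCentre_at148Letters` APPLIED with EVERY binder discharged in the kernel — exterior
`X = Unit` under `dirac ()`, block `ℝ¹`, kept cut `K = univ`, block potential `φ(w) = w₀²∕2 − w₀∕24` (convex; its
minimiser is `w₀ = 1∕24`, NOT the centre), centre `m = 0` with the first-order model `G = 1∕24`, `γ = 1` (sup norm),
statistic `U = |w₀|` (modulus `1 + αβs = 1`; radially transversal with `κ₀ = 1`), print's letters at `α = β = s = 0`,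
`P = E = 1` (letter `θ = 1`, core reading `αβs·E = 0`), relative shell width `ρ = ½`, `C = univ`, `Env = {U < 1}` (odds
`Q = 0`) — and the located clause `24·G ≤ γ·E` holds WITH EQUALITY.  A satisfiability witness, not an estimate on
Bałaban's measure. [textbook] -/
theorem lowCentreAt148Letters_binders_inhabited :
    SlotAntiConcentration
      ((((Measure.dirac ()).prod (volume : Measure (Fin 1 → ℝ))).withDensity
          fun p : Unit × (Fin 1 → ℝ) =>
            (univ : Set (Fin 1 → ℝ)).indicator
              (fun w => ENNReal.ofReal (Real.exp (-(w 0 ^ 2 / 2 - w 0 / 24)))) p.2).restrict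
        ({p : Unit × (Fin 1 → ℝ) | |p.2 0| < (1 - 0 * (1 - 0 / 2)) * 1 * 1} ∩ univ))
      (fun p : Unit × (Fin 1 → ℝ) => |p.2 0|) ((1 - 0 * (1 - 0 / 2)) * 1 * 1) (1 / 2)
      (3 * ((Fintype.card (Fin 1) : ℝ) + 1) * (1 + 0) / (1 * (1 - 1 / 2))) := by
  have hU : Measurable fun p : Unit × (Fin 1 → ℝ) => |p.2 0| := ((measurable_pi_apply 0).comp measurable_snd).abs
  have hφm : Measurable fun w : Fin 1 → ℝ => w 0 ^ 2 / 2 - w 0 / 24 :=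
    (((measurable_pi_apply 0).pow_const 2).div_const 2).sub ((measurable_pi_apply 0).div_const 24)
  have hg : Measurable fun p : Unit × (Fin 1 → ℝ) =>
      (univ : Set (Fin 1 → ℝ)).indicator (fun w => ENNReal.ofReal (Real.exp (-(w 0 ^ 2 / 2 - w 0 / 24)))) p.2 := by
    simp only [indicator_univ]
    exact (ENNReal.measurable_ofReal.comp (Real.measurable_exp.comp hφm.neg)).comp measurable_snd
  have hEnv : MeasurableSet {p : Unit × (Fin 1 → ℝ) | |p.2 0| < 1} := measurableSet_lt hU measurable_const
  have hcard : (Fintype.card (Fin 1) : ℝ) = 1 := by simp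
  refine slotAntiConcentration_restrict_of_lowCentre_at148Letters (Measure.dirac ()) (m := fun _ => 0)
    measurable_const (fun _ => univ) (fun _ w => w 0 ^ 2 / 2 - w 0 / 24) hg hU MeasurableSet.univ hEnv
    (Env := {p : Unit × (Fin 1 → ℝ) | |p.2 0| < 1}) (α := 0) (β := 0) (s := 0) (P := 1) (E := 1) (κ₀ := 1)
    (Q := 0) (G := 1 / 24) (γ := 1) le_rfl (by norm_num) le_rfl (by norm_num) le_rfl zero_le_one le_rfl one_pos
    (by norm_num) (by norm_num) one_pos le_rfl one_pos (by norm_num) (fun _ => convex_univ)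
    (fun _ => convexOn_tiltedQuadratic_one) (fun _ => mem_univ _) ?_ ?_ ?_ ?_ ?_ ?_
  · -- hmodel: first-order model about the centre 0 with G = 1∕24, γ = 1 in the sup norm of ℝ¹ (`‖v‖ = |v 0|`, cf.
    -- the tree's `Literature.AlgebraicTopology.Homotopy.SerreInvariantCycles.norm_fin_one`, re-derived inline)
    intro _ v _
    have hnorm : ‖v‖ = |v 0| := by
      refine le_antisymm ((pi_norm_le_iff_of_nonneg (abs_nonneg _)).2 fun i => ?_) ?_
      · rw [Subsingleton.elim i 0, Real.norm_eq_abs]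
      · simpa only [Real.norm_eq_abs] using norm_le_pi_norm v 0
    simp only [Pi.zero_apply, sub_zero, hnorm, sq_abs]
    have : v 0 ≤ |v 0| := le_abs_self _
    nlinarith
  · -- hU: the coordinate statistic is 1-Lipschitz for the sup norm (modulus 1 + αβs = 1)
    intro _ a b
    have h := norm_le_pi_norm (a - b) 0
    rw [Pi.sub_apply, Real.norm_eq_abs] at h
    have h2 := abs_abs_sub_abs_le_abs_sub (a 0) (b 0)
    have h3 : (1 + 0 * 0 * 0) * ‖a - b‖ = ‖a - b‖ := by ring
    rw [h3]
    exact (le_abs_self _).trans (h2.trans h)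
  · -- hUc: the core reading of the centre is αβs·E = 0
    intro _
    simp
  · -- henv: contracted shell points stay in Env = {U < 1}
    intro l hl p _ h2 _
    rw [hcard] at hl
    have hl0 : 0 ≤ l := by have := hl.1; norm_num at this; linarith
    have h2' : |p.2 0| < 1 := by have h := h2; norm_num at h; exact h
    show |((0 : Fin 1 → ℝ) + l • (p.2 - 0)) 0| < 1
    simp only [zero_add, sub_zero, Pi.smul_apply, smul_eq_mul, abs_mul, abs_of_nonneg hl0]
    nlinarith [abs_nonneg (p.2 0), hl.2]
  · -- hRT: U = |w₀| is radially transversal with κ₀ = 1 on {½ ≤ U}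
    intro p h1 _ _ r hr _ _ _
    have h1' : 1 / 2 ≤ |p.2 0| := by have h := h1; norm_num at h; exact h
    show |p.2 0| + 1 * ((1 - 0 * (1 - 0 / 2)) * 1 * 1 * (1 - 1 / 2)) * (r - 1)
        ≤ |((0 : Fin 1 → ℝ) + r • (p.2 - 0)) 0|
    simp only [zero_add, sub_zero, Pi.smul_apply, smul_eq_mul]
    rw [abs_mul, abs_of_nonneg (by linarith : (0 : ℝ) ≤ r)]
    nlinarith [mul_nonneg (show (0 : ℝ) ≤ r - 1 by linarith) (show (0 : ℝ) ≤ |p.2 0| - 1 / 2 by linarith)]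
  · -- hQ: Env \ ({U < θ} ∩ univ) = ∅ since θ = 1
    have hempty : {p : Unit × (Fin 1 → ℝ) | |p.2 0| < 1} \
        ({p : Unit × (Fin 1 → ℝ) | |p.2 0| < (1 - 0 * (1 - 0 / 2)) * 1 * 1} ∩ univ) = ∅ := by
      ext p
      simp
    rw [hempty, measure_empty]
    exact zero_le

end Witness

end Summit.QuantumFields.YangMills.Theorems.N21LowCentreNumeral
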